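import Literature.Computability.Complexity.PolyExistsNTIMEClock
import HarnessLib

/-!
# The shuffle program of the `∃`-closure of `NSUBEXP`

Fourth of five files of the proof of `polyExists_NSUBEXP_subset_NSUBEXP` (`AaronsonVanMelkebeek2011.lean`).
After the truncating wrapper has cut the witness `v` of the new verifier to the clock length
(`PolyExistsNTIMEClock.lean`), the **shuffle** rearranges `⟨x, v⟩` into the input expected by
the verifier `M'` of the inner language: it reads the witness `y` of the projection off `v` — at
most `p(|x|)` doubled bits up to the separator (`readY`, `PolyExistsNTIMEArith.lean`) —, computes
the certificate budget `B = c' · 2^{⌊m^{1/r'}⌋} + c'` for `m = |⟨x, y⟩| = 2|x| + 2 + |y|`, keeps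
the next `B` symbols `z` of `v`, discards the rest, and outputs `⟨⟨x, y⟩, z⟩`:

  `shuffleOut p r' c' x v = boolPair (boolPair x y) z`.

The truncations make the output a legitimate input of `M'` (certificate within its length
bound) whatever `v` is, and leave an honest witness `v = SProg.dbl y ++ 0 1 z` unchanged. This file
programs the shuffle (`shuffleProg p r' c'`) over the register file of
`PolyExistsNTIMEPrograms.lean` and proves `runs_shuffleProg` with an explicit cost
`cShuffle p r' c' |x| |y| |v|`.

## References

* S. Arora, B. Barak, *Computational Complexity: A Modern Approach*, CUP 2009, §1.3, Def. 2.1.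
* T. Nipkow, G. Klein, *Concrete Semantics with Isabelle/HOL*, Springer 2014, Ch. 7.
-/

namespace Literature.Computability.Complexity

namespace PolyExistsNTIME

open ACom ExpPad

/-! ### The functions computed -/

/-- The certificate budget `B(m) = c' · 2^{⌊m^{1/r'}⌋} + c'` of the inner verifier on pairs of
length `m`. [folklore] -/
def lenB (r' c' m : ℕ) : ℕ := c' * 2 ^ Nat.nthRoot r' m + c'

/-- The projection witness read off `v`: at most `p(|x|)` doubled bits. [folklore] -/
noncomputable def yOf (p : Polynomial ℕ) (x v : List Bool) : List Bool := (readY (p.eval x.length) v).1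

/-- What remains of `v` after the projection witness. [folklore] -/
noncomputable def restOf (p : Polynomial ℕ) (x v : List Bool) : List Bool := (readY (p.eval x.length) v).2

/-- The certificate kept: the next `B(|⟨x, y⟩|)` symbols. [folklore] -/
noncomputable def zOf (p : Polynomial ℕ) (r' c' : ℕ) (x v : List Bool) : List Bool :=
  (restOf p x v).take (lenB r' c' (2 * x.length + 2 + (yOf p x v).length))

/-- **The output of the shuffle**: `⟨⟨x, y⟩, z⟩`. [folklore] -/
noncomputable def shuffleOut (p : Polynomial ℕ) (r' c' : ℕ) (x v : List Bool) : List Bool :=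
  boolPair (boolPair x (yOf p x v)) (zOf p r' c' x v)

/-- The projection witness has at most `p(|x|)` bits. [folklore] -/
theorem length_yOf_le (p : Polynomial ℕ) (x v : List Bool) : (yOf p x v).length ≤ p.eval x.length :=
  length_readY_fst_le _ _

/-- The kept certificate is within the budget of the inner verifier. [folklore] -/
theorem length_zOf_le (p : Polynomial ℕ) (r' c' : ℕ) (x v : List Bool) :
    (zOf p r' c' x v).length ≤ lenB r' c' (boolPair x (yOf p x v)).length := by
  rw [zOf, List.length_take, length_boolPair]
  exact Nat.min_le_left _ _

/-- The remainder is not longer than `v`. [folklore] -/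
theorem length_restOf_le (p : Polynomial ℕ) (x v : List Bool) : (restOf p x v).length ≤ v.length :=
  length_readY_snd_le _ _

/-- **Honest witnesses pass unchanged**: for `|y| ≤ p(|x|)` and `|z| ≤ B(|⟨x, y⟩|)`,
`shuffleOut (SProg.dbl y ++ 0 1 z) = ⟨⟨x, y⟩, z⟩`. [folklore] -/
theorem shuffleOut_honest (p : Polynomial ℕ) (r' c' : ℕ) {x y z : List Bool}
    (hy : y.length ≤ p.eval x.length) (hz : z.length ≤ lenB r' c' (boolPair x y).length) :
    shuffleOut p r' c' x (SProg.dbl y ++ false :: true :: z) = boolPair (boolPair x y) z := by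
  have h := readY_dbl_sep z hy
  have hy' : yOf p x (SProg.dbl y ++ false :: true :: z) = y := by rw [yOf, h]
  have hr' : restOf p x (SProg.dbl y ++ false :: true :: z) = z := by rw [restOf, h]
  rw [shuffleOut, zOf, hy', hr', List.take_of_length_le]
  rwa [length_boolPair] at hz

/-! ### Reading the projection witness -/

/-- `readPair`: pop a pair of symbols of the input: an equal pair `bb` is the bit `b` (pushed on
`yr`, counted in `m`), an unequal pair sets the flag `b`, a missing symbol does nothing.
[folklore] -/
def readPair : Prog :=
  pop .inp fun o => match o with
    | none => skip
    | some b => pop .inp fun o' => match o' with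
      | none => skip
      | some b' => if b = b' then (push .yr b ;; push .m true) else push .b true

/-- `yBody`: one budget unit of the witness reader — do nothing once the flag is set, otherwise
read a pair. [folklore] -/
def yBody : Prog := ifTop .b fun o => match o with
  | some _ => skip
  | none => readPair

/-- The loop-level reader (flag as third component): what the budget loop computes before the
final drop. [folklore] -/
def readYL : ℕ → List Bool → List Bool × List Bool × Bool
  | 0, v => ([], v, false)
  | _ + 1, [] => ([], [], false)
  | _ + 1, [_] => ([], [], false)
  | k + 1, b :: b' :: v =>
    if b = b' then (b :: (readYL k v).1, (readYL k v).2.1, (readYL k v).2.2) else ([], v, true)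

/-- `readY` is the loop-level reader followed by the final drop when no separator was met.
[folklore] -/
theorem readY_eq_readYL : ∀ (k : ℕ) (v : List Bool),
    readY k v = ((readYL k v).1, if (readYL k v).2.2 then (readYL k v).2.1 else (readYL k v).2.1.drop 2)
  | 0, v => by simp [readYL]
  | _ + 1, [] => by simp [readYL]
  | _ + 1, [_] => by simp [readYL]
  | k + 1, b :: b' :: v => by
    by_cases h : b = b'
    · subst h
      have ih := readY_eq_readYL k v
      simp only [readY_succ_cons_cons_self, readYL, if_true]
      rw [ih]
    · simp [readY_succ_cons_cons_ne k h, readYL, h]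

/-- On the empty input the loop-level reader returns nothing. [folklore] -/
@[simp] theorem readYL_nil (k : ℕ) : readYL k [] = ([], [], false) := by
  cases k <;> rfl

/-- The flag as register content. [folklore] -/
def flag (b : Bool) : List Bool := if b then [true] else []

/-- Burning the budget once the flag is set: `5` steps per unit. [folklore] -/
theorem runs_readYLoop_flag (i xr n t s e f yr zr o : List Bool) (k cnt : ℕ) :
    Runs (loop .a fun _ => yBody) (mk i xr n (un k) [true] t (un cnt) s e f yr zr o)
      (mk i xr n [] [true] t (un cnt) s e f yr zr o) (5 * k + 1) := by
  have h := runs_loop_inv (k := Rg.a) (f := fun _ => yBody)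
    (fun _ rest => mk i xr n rest [true] t (un cnt) s e f yr zr o)
    (fun _ _ => True) 3
    (fun _ _ _ => rfl)
    (fun done a rest _ => ⟨trivial, by
      rw [update_mk_a]
      exact Runs.ifTop_cons (k := Rg.b) (f := fun o => match o with
        | some _ => skip
        | none => readPair) rfl (Runs.skip _)⟩)
    (un k) [] trivial
  simpa [un] using h

/-- **The witness reader loop**: with budget `a = 1^k`, flag clear, input `v`, it ends with the
bits of `readYL k v` pushed on `yr` and counted in `m`, the remainder in the input, and the flag
of `readYL k v`, within `10 k + 1` steps. [folklore] -/
theorem runs_readYLoop (xr n t s e f zr o : List Bool) : ∀ (k : ℕ) (v yacc : List Bool) (cnt : ℕ),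
    Runs (loop .a fun _ => yBody) (mk v xr n (un k) [] t (un cnt) s e f yacc zr o)
      (mk (readYL k v).2.1 xr n [] (flag (readYL k v).2.2) t (un (cnt + (readYL k v).1.length)) s e f
        ((readYL k v).1.reverse ++ yacc) zr o) (10 * k + 1)
  | 0, v, yacc, cnt => by
    simpa [readYL, flag] using Runs.loop_nil (fun _ => yBody) (R := mk v xr n (un 0) [] t (un cnt) s e f yacc zr o) rfl
  | k + 1, [], yacc, cnt => by
    have hb : Runs yBody (mk [] xr n (un k) [] t (un cnt) s e f yacc zr o)
        (mk [] xr n (un k) [] t (un cnt) s e f yacc zr o) 4 :=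
      Runs.ifTop_nil (k := Rg.b) rfl (Runs.pop_nil (k := Rg.inp) rfl (Runs.skip _))
    have ih := runs_readYLoop xr n t s e f zr o k [] yacc cnt
    simp only [readYL_nil, flag] at ih
    have := Runs.loop_cons (k := Rg.a) (f := fun _ => yBody)
      (R := mk [] xr n (un (k + 1)) [] t (un cnt) s e f yacc zr o) (a := true) (w := un k) rfl
      (by rw [update_mk_a]; exact hb) ih
    simpa [readYL_nil, flag] using this.mono (by omega)
  | k + 1, [c], yacc, cnt => by
    have hb : Runs yBody (mk [c] xr n (un k) [] t (un cnt) s e f yacc zr o)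
        (mk [] xr n (un k) [] t (un cnt) s e f yacc zr o) 6 := by
      refine Runs.ifTop_nil (k := Rg.b) rfl ?_
      refine Runs.pop_cons (k := Rg.inp) (a := c) (w := []) rfl ?_
      rw [update_mk_inp]
      exact Runs.pop_nil (k := Rg.inp) rfl (Runs.skip _)
    have ih := runs_readYLoop xr n t s e f zr o k [] yacc cnt
    simp only [readYL_nil, flag] at ih
    have := Runs.loop_cons (k := Rg.a) (f := fun _ => yBody)
      (R := mk [c] xr n (un (k + 1)) [] t (un cnt) s e f yacc zr o) (a := true) (w := un k) rfl
      (by rw [update_mk_a]; exact hb) ih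
    simpa [readYL, flag] using this.mono (by omega)
  | k + 1, c :: c' :: v, yacc, cnt => by
    by_cases hc : c = c'
    · subst hc
      have hb : Runs yBody (mk (c :: c :: v) xr n (un k) [] t (un cnt) s e f yacc zr o)
          (mk v xr n (un k) [] t (un (cnt + 1)) s e f (c :: yacc) zr o) 8 := by
        refine Runs.ifTop_nil (k := Rg.b) rfl ?_
        refine Runs.pop_cons (k := Rg.inp) (a := c) (w := c :: v) rfl ?_
        rw [update_mk_inp]
        refine Runs.pop_cons (k := Rg.inp) (a := c) (w := v) rfl ?_
        rw [update_mk_inp]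
        simp only [if_true]
        refine ((Runs.push' rfl).seq (Runs.push' ?_)).of_eq rfl (by norm_num)
        simp [un_succ]
      have ih := runs_readYLoop xr n t s e f zr o k v (c :: yacc) (cnt + 1)
      have := Runs.loop_cons (k := Rg.a) (f := fun _ => yBody)
        (R := mk (c :: c :: v) xr n (un (k + 1)) [] t (un cnt) s e f yacc zr o) (a := true) (w := un k) rfl
        (by rw [update_mk_a]; exact hb) ih
      refine this.of_eq ?_ (by omega)
      simp [readYL, Nat.add_assoc, Nat.add_comm 1]
    · have hb : Runs yBody (mk (c :: c' :: v) xr n (un k) [] t (un cnt) s e f yacc zr o)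
          (mk v xr n (un k) [true] t (un cnt) s e f yacc zr o) 7 := by
        refine Runs.ifTop_nil (k := Rg.b) rfl ?_
        refine Runs.pop_cons (k := Rg.inp) (a := c) (w := c' :: v) rfl ?_
        rw [update_mk_inp]
        refine Runs.pop_cons (k := Rg.inp) (a := c') (w := v) rfl ?_
        rw [update_mk_inp]
        simp only [hc, if_false]
        exact Runs.push' (by simp)
      have hburn := runs_readYLoop_flag v xr n t s e f yacc zr o k cnt
      have := Runs.loop_cons (k := Rg.a) (f := fun _ => yBody)
        (R := mk (c :: c' :: v) xr n (un (k + 1)) [] t (un cnt) s e f yacc zr o) (a := true) (w := un k) rfl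
        (by rw [update_mk_a]; exact hb) hburn
      refine this.of_eq ?_ (by omega)
      simp [readYL, hc, flag]

/-- `yPost`: after the budget loop — pop the flag if set, otherwise drop the next two input
symbols. [folklore] -/
def yPost : Prog := pop .b fun o => match o with
  | some _ => skip
  | none => pop .inp fun _ => pop .inp fun _ => skip

/-- Effect of `yPost` with the flag set. [folklore] -/
theorem runs_yPost_true (i xr n t m s e f yr zr o : List Bool) :
    Runs yPost (mk i xr n [] [true] t m s e f yr zr o) (mk i xr n [] [] t m s e f yr zr o) 6 := by
  have h : Runs yPost (mk i xr n [] [true] t m s e f yr zr o) (mk i xr n [] [] t m s e f yr zr o) 2 := by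
    refine Runs.pop_cons (k := Rg.b) (a := true) (w := []) rfl ?_
    rw [update_mk_b]; exact Runs.skip _
  exact h.mono (by norm_num)

/-- Effect of `yPost` with the flag clear: two input symbols are dropped. [folklore] -/
theorem runs_yPost_false (i xr n t m s e f yr zr o : List Bool) :
    Runs yPost (mk i xr n [] [] t m s e f yr zr o) (mk (i.drop 2) xr n [] [] t m s e f yr zr o) 6 := by
  refine Runs.pop_nil (k := Rg.b) rfl ?_
  rcases i with _ | ⟨c, _ | ⟨c', i⟩⟩
  · exact Runs.pop_nil (k := Rg.inp) rfl (Runs.pop_nil (k := Rg.inp) rfl (Runs.skip _))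
  · refine Runs.pop_cons (k := Rg.inp) (a := c) (w := []) rfl ?_
    rw [update_mk_inp]
    exact Runs.pop_nil (k := Rg.inp) rfl (Runs.skip _)
  · refine Runs.pop_cons (k := Rg.inp) (a := c) (w := c' :: i) rfl ?_
    rw [update_mk_inp]
    refine Runs.pop_cons (k := Rg.inp) (a := c') (w := i) rfl ?_
    rw [update_mk_inp]
    exact Runs.skip _

/-- **The witness reading phase** `readYPhase = loop a yBody ;; yPost`: with budget `a = 1^k` it
reads `readY k v` — bits reversed on `yr`, their number in `m`, the remainder left in the input.
[folklore] -/
def readYPhase : Prog := (loop .a fun _ => yBody) ;; yPost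

/-- Effect and cost of `readYPhase`. [folklore] -/
theorem runs_readYPhase (xr n t s e f zr o : List Bool) (k : ℕ) (v : List Bool) :
    Runs readYPhase (mk v xr n (un k) [] t [] s e f [] zr o)
      (mk (readY k v).2 xr n [] [] t (un (readY k v).1.length) s e f (readY k v).1.reverse zr o)
      (10 * k + 7) := by
  have h1 := runs_readYLoop xr n t s e f zr o k v [] 0
  simp only [List.append_nil, Nat.zero_add] at h1
  rw [readY_eq_readYL]
  unfold readYPhase
  cases hfl : (readYL k v).2.2
  · rw [hfl] at h1
    simp only [flag] at h1
    have h2 := runs_yPost_false (readYL k v).2.1 xr n t (un (readYL k v).1.length) s e f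
      (readYL k v).1.reverse zr o
    simpa using (h1.seq h2)
  · rw [hfl] at h1
    simp only [flag, if_true] at h1
    have h2 := runs_yPost_true (readYL k v).2.1 xr n t (un (readYL k v).1.length) s e f
      (readYL k v).1.reverse zr o
    simpa using (h1.seq h2)

/-! ### The length `m = 2n + 2 + |y|` -/

/-- `addTwoN`: add `2|n| + 2` tokens to `m`, consuming `n`. [folklore] -/
def addTwoN : Prog := loop .n (fun _ => push .m true ;; push .m true) ;; push .m true ;; push .m true

/-- Effect and cost of `addTwoN`. [folklore] -/
theorem runs_addTwoN (i xr a b t s e f yr zr o : List Bool) (k c : ℕ) :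
    Runs addTwoN (mk i xr (un k) a b t (un c) s e f yr zr o)
      (mk i xr [] a b t (un (2 * k + 2 + c)) s e f yr zr o) (4 * k + 3) := by
  have h1 := runs_loop_inv (k := Rg.n) (f := fun _ => push .m true ;; push .m true)
    (fun done rest => mk i xr rest a b t (un (2 * done.length + c)) s e f yr zr o)
    (fun _ _ => True) 2
    (fun _ _ _ => rfl)
    (fun done a rest _ => ⟨trivial, by
      refine ((Runs.push' rfl).seq (Runs.push' ?_)).of_eq rfl (by norm_num)
      have e1 : 2 * (done.length + 1) + c = (2 * done.length + c) + 1 + 1 := by ring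
      simp [un, List.replicate_succ, e1]⟩)
    (un k) [] trivial
  have h1' : Runs (loop Rg.n fun _ => push Rg.m true ;; push Rg.m true)
      (mk i xr (un k) a b t (un c) s e f yr zr o) (mk i xr [] a b t (un (2 * k + c)) s e f yr zr o)
      (4 * k + 1) := by
    simpa [un] using h1
  have h2 : Runs (push Rg.m true) (mk i xr [] a b t (un (2 * k + c)) s e f yr zr o)
      (mk i xr [] a b t (un (2 * k + c + 1)) s e f yr zr o) 1 := Runs.push' (by simp [un_succ])
  have h3 : Runs (push Rg.m true) (mk i xr [] a b t (un (2 * k + c + 1)) s e f yr zr o)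
      (mk i xr [] a b t (un (2 * k + c + 2)) s e f yr zr o) 1 := Runs.push' (by simp [un_succ])
  unfold addTwoN
  refine (h1'.seq (h2.seq h3)).of_eq ?_ (by omega)
  rw [show 2 * k + c + 2 = 2 * k + 2 + c by omega]

/-! ### The certificate budget and the certificate -/

/-- `budget c'`: `a := 1^{c'·|e| + c'}`, consuming `e`. [folklore] -/
def budget (c' : ℕ) : Prog := loop .e (fun _ => pushList .a (un c')) ;; pushList .a (un c')

/-- Effect and cost of `budget`. [folklore] -/
theorem runs_budget (c' : ℕ) (i xr n b t m s f yr zr o : List Bool) (E : ℕ) :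
    Runs (budget c') (mk i xr n [] b t m s (un E) f yr zr o)
      (mk i xr n (un (c' * E + c')) b t m s [] f yr zr o) ((c' + 2) * E + 1 + c') := by
  have h1 := runs_loop_inv (k := Rg.e) (f := fun _ => pushList .a (un c'))
    (fun done rest => mk i xr n (un (c' * done.length)) b t m s rest f yr zr o)
    (fun _ _ => True) c'
    (fun _ _ _ => rfl)
    (fun done a rest _ => ⟨trivial, by
      have := runs_pushList (Γ := Bool) Rg.a (un c')
        (mk i xr n (un (c' * done.length)) b t m s rest f yr zr o)
      simp only [mk_a, update_mk_a, un, List.reverse_replicate, List.length_replicate,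
        List.replicate_append_replicate] at this
      simp only [update_mk_e, List.length_cons, un]
      refine this.of_eq ?_ le_rfl
      rw [Nat.mul_succ, Nat.add_comm]⟩)
    (un E) [] trivial
  have h1' : Runs (loop Rg.e fun _ => pushList Rg.a (un c'))
      (mk i xr n [] b t m s (un E) f yr zr o) (mk i xr n (un (c' * E)) b t m s [] f yr zr o)
      ((c' + 2) * E + 1) := by
    simpa [un] using h1
  have h2 := runs_pushList (Γ := Bool) Rg.a (un c') (mk i xr n (un (c' * E)) b t m s [] f yr zr o)
  simp only [mk_a, update_mk_a, un, List.reverse_replicate, List.length_replicate,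
    List.replicate_append_replicate] at h2
  have h2' : Runs (pushList Rg.a (un c')) (mk i xr n (un (c' * E)) b t m s [] f yr zr o)
      (mk i xr n (un (c' * E + c')) b t m s [] f yr zr o) c' := by
    refine h2.of_eq ?_ le_rfl
    simp [un, Nat.add_comm]
  unfold budget
  exact h1'.seq h2'

/-- `readZ`: move up to `|a|` input symbols onto `zr`, consuming `a`. [folklore] -/
def readZ : Prog := loop .a fun _ => pop .inp fun o => match o with
  | some b => push .zr b
  | none => skip

/-- Effect and cost of `readZ`: `zr := (v ↾ B).reverse ++ zr`, input `:= v.drop B`. [folklore] -/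
theorem runs_readZ (xr n b t m s e f yr o : List Bool) : ∀ (B : ℕ) (v zacc : List Bool),
    Runs readZ (mk v xr n (un B) b t m s e f yr zacc o)
      (mk (v.drop B) xr n [] b t m s e f yr ((v.take B).reverse ++ zacc) o) (5 * B + 1)
  | 0, v, zacc => by
    simpa [readZ] using Runs.loop_nil (fun _ => pop Rg.inp fun o => match o with
      | some b => push Rg.zr b
      | none => skip) (R := mk v xr n (un 0) b t m s e f yr zacc o) rfl
  | B + 1, [], zacc => by
    have hb : Runs (pop Rg.inp fun o => match o with
        | some b => push Rg.zr b
        | none => skip) (mk [] xr n (un B) b t m s e f yr zacc o) (mk [] xr n (un B) b t m s e f yr zacc o) 2 :=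
      Runs.pop_nil (k := Rg.inp) rfl (Runs.skip _)
    have ih := runs_readZ xr n b t m s e f yr o B [] zacc
    simp only [List.drop_nil, List.take_nil, List.reverse_nil, List.nil_append] at ih
    have := Runs.loop_cons (k := Rg.a) (f := fun _ => pop Rg.inp fun o => match o with
        | some b => push Rg.zr b
        | none => skip)
      (R := mk [] xr n (un (B + 1)) b t m s e f yr zacc o) (a := true) (w := un B) rfl
      (by rw [update_mk_a]; exact hb) ih
    unfold readZ
    simpa using this.mono (by omega)
  | B + 1, c :: v, zacc => by
    have hb : Runs (pop Rg.inp fun o => match o with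
        | some b => push Rg.zr b
        | none => skip) (mk (c :: v) xr n (un B) b t m s e f yr zacc o)
        (mk v xr n (un B) b t m s e f yr (c :: zacc) o) 3 := by
      refine Runs.pop_cons (k := Rg.inp) (a := c) (w := v) rfl ?_
      rw [update_mk_inp]
      exact Runs.push' (by simp)
    have ih := runs_readZ xr n b t m s e f yr o B v (c :: zacc)
    have := Runs.loop_cons (k := Rg.a) (f := fun _ => pop Rg.inp fun o => match o with
        | some b => push Rg.zr b
        | none => skip)
      (R := mk (c :: v) xr n (un (B + 1)) b t m s e f yr zacc o) (a := true) (w := un B) rfl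
      (by rw [update_mk_a]; exact hb) ih
    unfold readZ
    refine this.of_eq ?_ (by omega)
    simp

/-! ### Writing the output `⟨⟨x, y⟩, z⟩` -/

/-- `dbl` distributes over concatenation. [folklore] -/
theorem dbl_append (u v : List Bool) : SProg.dbl (u ++ v) = SProg.dbl u ++ SProg.dbl v := by
  simp [SProg.dbl, List.flatMap_append]

/-- `output`: write `z` (from `zr`), the separator, `dbl y` (from `yr`), the doubled separator,
and `dbl (SProg.dbl x)` (from `xr`) — the word `boolPair (boolPair x y) z`. [folklore] -/
def output : Prog :=
  pour .zr .out ;; push .out true ;; push .out false ;;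
  loop .yr (fun b => push .out b ;; push .out b) ;;
  push .out true ;; push .out true ;; push .out false ;; push .out false ;;
  loop .xr (fun b => push .out b ;; push .out b ;; push .out b ;; push .out b)

/-- Effect and cost of `output`. [folklore] -/
theorem runs_output (x y z m : List Bool) :
    Runs output (mk [] x.reverse [] [] [] [] m [] [] [] y.reverse z.reverse [])
      (mk [] [] [] [] [] [] m [] [] [] [] [] (boolPair (boolPair x y) z))
      ((3 * z.length + 1) + 2 + (4 * y.length + 1) + 4 + (6 * x.length + 1)) := by
  have h1 := runs_pour (Γ := Bool) (a := Rg.zr) (b := Rg.out) (by decide)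
    (mk [] x.reverse [] [] [] [] m [] [] [] y.reverse z.reverse [])
  simp only [mk_zr, mk_out, List.reverse_reverse, List.append_nil, update_mk_zr, update_mk_out,
    List.length_reverse] at h1
  have h2 : Runs (push Rg.out true) (mk [] x.reverse [] [] [] [] m [] [] [] y.reverse [] z)
      (mk [] x.reverse [] [] [] [] m [] [] [] y.reverse [] (true :: z)) 1 := Runs.push' (by simp)
  have h3 : Runs (push Rg.out false) (mk [] x.reverse [] [] [] [] m [] [] [] y.reverse [] (true :: z))
      (mk [] x.reverse [] [] [] [] m [] [] [] y.reverse [] (false :: true :: z)) 1 := Runs.push' (by simp)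
  have h4 := runs_loop_inv (k := Rg.yr) (f := fun b => push .out b ;; push .out b)
    (fun done rest => mk [] x.reverse [] [] [] [] m [] [] [] rest [] (SProg.dbl done ++ false :: true :: z))
    (fun _ _ => True) 2
    (fun _ _ _ => rfl)
    (fun done a rest _ => ⟨trivial, by
      refine ((Runs.push' rfl).seq (Runs.push' ?_)).of_eq rfl (by norm_num)
      simp⟩)
    y.reverse [] trivial
  have h4' : Runs (loop Rg.yr fun b => push Rg.out b ;; push Rg.out b)
      (mk [] x.reverse [] [] [] [] m [] [] [] y.reverse [] (false :: true :: z))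
      (mk [] x.reverse [] [] [] [] m [] [] [] [] [] (SProg.dbl y ++ false :: true :: z)) (4 * y.length + 1) := by
    simpa using h4
  set w := SProg.dbl y ++ false :: true :: z with hw
  have h5 : Runs (push Rg.out true) (mk [] x.reverse [] [] [] [] m [] [] [] [] [] w)
      (mk [] x.reverse [] [] [] [] m [] [] [] [] [] (true :: w)) 1 := Runs.push' (by simp)
  have h6 : Runs (push Rg.out true) (mk [] x.reverse [] [] [] [] m [] [] [] [] [] (true :: w))
      (mk [] x.reverse [] [] [] [] m [] [] [] [] [] (true :: true :: w)) 1 := Runs.push' (by simp)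
  have h7 : Runs (push Rg.out false) (mk [] x.reverse [] [] [] [] m [] [] [] [] [] (true :: true :: w))
      (mk [] x.reverse [] [] [] [] m [] [] [] [] [] (false :: true :: true :: w)) 1 := Runs.push' (by simp)
  have h8 : Runs (push Rg.out false) (mk [] x.reverse [] [] [] [] m [] [] [] [] [] (false :: true :: true :: w))
      (mk [] x.reverse [] [] [] [] m [] [] [] [] [] (false :: false :: true :: true :: w)) 1 :=
    Runs.push' (by simp)
  have h9 := runs_loop_inv (k := Rg.xr) (f := fun b => push .out b ;; push .out b ;; push .out b ;; push .out b)
    (fun done rest => mk [] rest [] [] [] [] m [] [] [] [] []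
      (SProg.dbl (SProg.dbl done) ++ false :: false :: true :: true :: w))
    (fun _ _ => True) 4
    (fun _ _ _ => rfl)
    (fun done a rest _ => ⟨trivial, by
      refine ((Runs.push' rfl).seq ((Runs.push' rfl).seq ((Runs.push' rfl).seq
        (Runs.push' ?_)))).of_eq rfl (by norm_num)
      simp⟩)
    x.reverse [] trivial
  have h9' : Runs (loop Rg.xr fun b => push Rg.out b ;; push Rg.out b ;; push Rg.out b ;; push Rg.out b)
      (mk [] x.reverse [] [] [] [] m [] [] [] [] [] (false :: false :: true :: true :: w))
      (mk [] [] [] [] [] [] m [] [] [] [] [] (boolPair (boolPair x y) z)) (6 * x.length + 1) := by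
    have e : boolPair (boolPair x y) z = SProg.dbl (SProg.dbl x) ++ false :: false :: true :: true :: w := by
      simp [boolPair_eq_dbl, dbl_append, hw]
    rw [e]
    simpa using h9
  unfold output
  exact (h1.seq (h2.seq (h3.seq (h4'.seq (h5.seq (h6.seq (h7.seq (h8.seq h9')))))))).of_eq rfl (by omega)

/-! ### The processing of the witness (everything after the first component) -/

/-- `restProg p r' c'`: with `x` read (reversed on `xr`, its length on `n`) and the witness `v`
on the input — evaluate `p(n)`, read `y`, form `m`, take the root, exponentiate, form the
budget, read `z`, discard the rest, and write `⟨⟨x, y⟩, z⟩`. [folklore] -/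
noncomputable def restProg (p : Polynomial ℕ) (r' c' : ℕ) : Prog :=
  horner (coeffList p) ;; readYPhase ;; addTwoN ;; push .e true ;; rootLoop r' ;; push .e true ;;
  (loop .s fun _ => dblE) ;; budget c' ;; readZ ;; clear .inp ;; clear .m ;; output

/-- Cost bound of `restProg` in terms of `n = |x|`, `ylen = |y|`, `vlen = |v|`, the value
`P = p(n)` and the Horner cost `H`. [folklore] -/
def cRestCore (r' c' n ylen vlen P H : ℕ) : ℕ :=
  H + (10 * P + 7) + (4 * n + 3) + 1 +
  ((2 * n + 2 + ylen + 2) * (cRootIter r' (2 * n + 2 + ylen) + 2) + 1) + 1 +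
  cExp (Nat.nthRoot r' (2 * n + 2 + ylen)) 1 +
  ((c' + 2) * 2 ^ Nat.nthRoot r' (2 * n + 2 + ylen) + 1 + c') +
  (5 * lenB r' c' (2 * n + 2 + ylen) + 1) + (2 * vlen + 1) + (2 * (2 * n + 2 + ylen) + 1) +
  ((3 * lenB r' c' (2 * n + 2 + ylen) + 1) + 2 + (4 * ylen + 1) + 4 + (6 * n + 1))

/-- **Cost bound of `restProg`.** [folklore] -/
noncomputable def cRest (p : Polynomial ℕ) (r' c' n ylen vlen : ℕ) : ℕ :=
  cRestCore r' c' n ylen vlen (p.eval n) (cHorner n (coeffList p))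

/-- **Specification of `restProg`** (`r' ≠ 0`). [folklore] -/
theorem runs_restProg (p : Polynomial ℕ) {r' : ℕ} (hr' : r' ≠ 0) (c' : ℕ) (x v : List Bool) :
    Runs (restProg p r' c') (mk v x.reverse (un x.length) [] [] [] [] [] [] [] [] [] [])
      (mk [] [] [] [] [] [] [] [] [] [] [] [] (shuffleOut p r' c' x v))
      (cRest p r' c' x.length (yOf p x v).length v.length) := by
  set n := x.length with hn
  set P := p.eval n with hP
  set y := (readY P v).1 with hy
  set rest := (readY P v).2 with hrest
  have hy' : yOf p x v = y := by rw [yOf, ← hn, ← hP]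
  have hrest' : restOf p x v = rest := by rw [restOf, ← hn, ← hP]
  set μ := 2 * n + 2 + y.length with hμ
  set σ := Nat.nthRoot r' μ with hσ
  set B := lenB r' c' μ with hB
  have hz' : zOf p r' c' x v = rest.take B := by rw [zOf, hrest', hy', ← hn]
  -- the phases
  have h1 := runs_horner v x.reverse [] [] [] [] [] [] [] n (coeffList p)
  rw [hornerVal_coeffList, ← hP] at h1
  have h2 := runs_readYPhase x.reverse (un n) [] [] [] [] [] [] P v
  rw [← hy, ← hrest] at h2
  have h3 := runs_addTwoN rest x.reverse [] [] [] [] [] [] y.reverse [] [] n y.length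
  rw [← hμ] at h3
  have h4 : Runs (push Rg.e true) (mk rest x.reverse [] [] [] [] (un μ) [] [] [] y.reverse [] [])
      (mk rest x.reverse [] [] [] [] (un μ) [] [true] [] y.reverse [] []) 1 := Runs.push' (by simp)
  have h5 := runs_root hr' rest x.reverse [] [] y.reverse [] [] μ
  rw [← hσ] at h5
  have h6 : Runs (push Rg.e true) (mk rest x.reverse [] [] [] [] (un μ) (un σ) [] [] y.reverse [] [])
      (mk rest x.reverse [] [] [] [] (un μ) (un σ) (un 1) [] y.reverse [] []) 1 := Runs.push' (by simp [un])
  have h7 := runs_exp2 rest x.reverse [] [] [] [] (un μ) y.reverse [] [] σ 1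
  rw [one_mul] at h7
  have h8 := runs_budget c' rest x.reverse [] [] [] (un μ) [] [] y.reverse [] [] (2 ^ σ)
  have hB' : c' * 2 ^ σ + c' = B := by rw [hB, lenB, hσ]
  rw [hB'] at h8
  have h9 := runs_readZ x.reverse [] [] [] (un μ) [] [] [] y.reverse [] B rest []
  rw [List.append_nil] at h9
  have h10 := runs_clear (Γ := Bool) Rg.inp
    (mk (rest.drop B) x.reverse [] [] [] [] (un μ) [] [] [] y.reverse (rest.take B).reverse [])
  simp only [mk_inp, update_mk_inp] at h10
  have h10' : Runs (clear Rg.inp)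
      (mk (rest.drop B) x.reverse [] [] [] [] (un μ) [] [] [] y.reverse (rest.take B).reverse [])
      (mk [] x.reverse [] [] [] [] (un μ) [] [] [] y.reverse (rest.take B).reverse []) (2 * v.length + 1) := by
    refine h10.mono ?_
    have : (rest.drop B).length ≤ v.length := by
      rw [List.length_drop]
      exact (Nat.sub_le _ _).trans (by rw [hrest]; exact length_readY_snd_le _ _)
    omega
  have h11 := runs_clear (Γ := Bool) Rg.m
    (mk [] x.reverse [] [] [] [] (un μ) [] [] [] y.reverse (rest.take B).reverse [])
  simp only [mk_m, update_mk_m, un, List.length_replicate] at h11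
  have h12 := runs_output x y (rest.take B) []
  have h12' : Runs output (mk [] x.reverse [] [] [] [] [] [] [] [] y.reverse (rest.take B).reverse [])
      (mk [] [] [] [] [] [] [] [] [] [] [] [] (boolPair (boolPair x y) (rest.take B)))
      ((3 * B + 1) + 2 + (4 * y.length + 1) + 4 + (6 * n + 1)) := by
    refine h12.mono ?_
    have : (rest.take B).length ≤ B := by rw [List.length_take]; exact Nat.min_le_left _ _
    omega
  have := h1.seq (h2.seq (h3.seq (h4.seq (h5.seq (h6.seq (h7.seq (h8.seq (h9.seq (h10'.seq (h11.seq h12'))))))))))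
  unfold restProg
  refine this.of_eq ?_ ?_
  · rw [shuffleOut, hy', hz']
  · rw [hy', cRest, cRestCore, ← hP, ← hμ, ← hσ, ← hB]
    omega

/-! ### The shuffle program -/

/-- The body of the outer loop: pop the second symbol of the pair; an equal pair is a symbol of
`x` (pushed on `xr`, counted in `n`), the first unequal pair is the separator after which the
witness is processed by `restProg`. [folklore] -/
noncomputable def xBody (p : Polynomial ℕ) (r' c' : ℕ) (b : Bool) : Prog :=
  pop .inp fun o => match o with
    | some b' => if b = b' then (push .xr b ;; push .n true) else restProg p r' c'
    | none => skip

/-- **The shuffle program** `⟨x, v⟩ ↦ ⟨⟨x, y⟩, z⟩` (`shuffleOut p r' c' x v`). [folklore] -/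
noncomputable def shuffleProg (p : Polynomial ℕ) (r' c' : ℕ) : Prog :=
  loop .inp (xBody p r' c')

/-- The loop segment over the doubled first component. [folklore] -/
theorem segRuns_x (p : Polynomial ℕ) (r' c' : ℕ) (v : List Bool) : ∀ (x done : List Bool),
    SegRuns .inp (xBody p r' c') x
      (mk (SProg.dbl x ++ false :: true :: v) done (un done.length) [] [] [] [] [] [] [] [] [] [])
      (mk (false :: true :: v) (x.reverse ++ done) (un (done.length + x.length)) [] [] [] [] [] [] [] [] [] [])
      (6 * x.length)
  | [], done => by
    simpa using SegRuns.nil Rg.inp (xBody p r' c')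
      (mk (false :: true :: v) done (un done.length) [] [] [] [] [] [] [] [] [] [])
  | b :: x, done => by
    have hb : Runs (xBody p r' c' b)
        (mk (b :: (SProg.dbl x ++ false :: true :: v)) done (un done.length) [] [] [] [] [] [] [] [] [] [])
        (mk (SProg.dbl x ++ false :: true :: v) (b :: done) (un (done.length + 1)) [] [] [] [] [] [] [] [] [] []) 4 := by
      refine Runs.pop_cons (k := Rg.inp) (a := b) (w := SProg.dbl x ++ false :: true :: v) rfl ?_
      rw [update_mk_inp]
      simp only [if_true]
      refine ((Runs.push' rfl).seq (Runs.push' ?_)).of_eq rfl (by norm_num)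
      simp [un_succ]
    have ih := segRuns_x p r' c' v x (b :: done)
    have := SegRuns.cons (k := Rg.inp) (f := xBody p r' c')
      (R := mk (SProg.dbl (b :: x) ++ false :: true :: v) done (un done.length) [] [] [] [] [] [] [] [] [] [])
      (a := b) (w := b :: (SProg.dbl x ++ false :: true :: v)) rfl (by rw [update_mk_inp]; exact hb) ih
    refine this.of_eq ?_ ?_
    · simp [Nat.add_assoc, Nat.add_comm 1]
    · simp only [List.length_cons]; omega

/-- **Cost bound of the shuffle program.** [folklore] -/
noncomputable def cShuffle (p : Polynomial ℕ) (r' c' n ylen vlen : ℕ) : ℕ :=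
  6 * n + cRest p r' c' n ylen vlen + 5

/-- **Specification of the shuffle program** (`r' ≠ 0`): on `boolPair x v` it outputs
`shuffleOut p r' c' x v = ⟨⟨x, y⟩, z⟩` within `cShuffle p r' c' |x| |y| |v|` steps. [folklore] -/
theorem runs_shuffleProg (p : Polynomial ℕ) {r' : ℕ} (hr' : r' ≠ 0) (c' : ℕ) (x v : List Bool) :
    Runs (shuffleProg p r' c') (AStore.single .inp (boolPair x v))
      (AStore.single .out (shuffleOut p r' c' x v))
      (cShuffle p r' c' x.length (yOf p x v).length v.length) := by
  rw [single_inp, single_out, boolPair_eq_dbl]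
  have hseg := segRuns_x p r' c' v x []
  simp only [List.length_nil, List.append_nil, Nat.zero_add] at hseg
  have hrest := runs_restProg p hr' c' x v
  have hbody : Runs (xBody p r' c' false)
      (mk (true :: v) x.reverse (un x.length) [] [] [] [] [] [] [] [] [] [])
      (mk [] [] [] [] [] [] [] [] [] [] [] [] (shuffleOut p r' c' x v))
      (cRest p r' c' x.length (yOf p x v).length v.length + 2) := by
    refine Runs.pop_cons (k := Rg.inp) (a := true) (w := v) rfl ?_
    rw [update_mk_inp]
    simpa using hrest
  have hsep := Runs.loop_cons (k := Rg.inp) (f := xBody p r' c')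
    (R := mk (false :: true :: v) x.reverse (un x.length) [] [] [] [] [] [] [] [] [] [])
    (a := false) (w := true :: v) rfl (by rw [update_mk_inp]; exact hbody)
    (Runs.loop_nil (xBody p r' c') (R := mk [] [] [] [] [] [] [] [] [] [] [] [] (shuffleOut p r' c' x v)) rfl)
  have := hseg.runs_loop hsep
  unfold shuffleProg
  refine this.of_eq rfl ?_
  unfold cShuffle; omega

end PolyExistsNTIME

end Literature.Computability.Complexity
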